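import Literature.AlgebraicGeometry.Frobenioids.PadicKummerSettingProofs
import HarnessLib

/-!
# Frobenioids II, Theorem 2.4 (i): `O^□(A₁)^{H₁} ⥲ O^□(A₂)^{H₂}` and the compatibility with the
# Kummer and reciprocity MAPS of Definition 2.3

Mochizuki, *The geometry of Frobenioids II*, Kyushu J. Math. **62** (2008) 401–460, §2, Theorem 2.4
(i) p. 19 [cite: MochizukiFrdII2008, Thm 2.4 (i) p.19]: `Ψ` "induces isomorphisms of monoids/modules
`O^□(A₁)^{H₁} ⥲ O^□(A₂)^{H₂}`; … which are compatible with the respective Kummer and reciprocity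
maps `O^□(Aᵢ)^{Hᵢ} → H¹((Hᵢ)_{Aᵢ}, μ_N(Aᵢ))`; `O^□(Aᵢ)^{Hᵢ} → (Hᵢ)^ab_{Aᵢ} ⊗ F_N(Aᵢ)`".

PROOF-SIDE companion (seat abc-iut-L1-d4, gen 2) to `PadicKummerIsoTransport.lean` /
`PadicKummerSettingProofs.lean`, phrasing the compatibility LITERALLY for abc-iut-L1-t7's Definition
2.3 maps (`Kummer.kummerMapOfRoots`, `Kummer.reciprocityMap`, `KummerReciprocity.lean`): along a
context isomorphism `e : X₁.Iso X₂`, (1) the FIRST listed isomorphism `O^□(A₁)^{H₁} ⥲ O^□(A₂)^{H₂}`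
is CONSTRUCTED (`isoInvariants`, the restriction of `isoO` — abc-iut-L1-t7's `Thm24Data.isoO` is
recorded on all of `O^□`); (2) the square with the Kummer maps of Def. 2.3 commutes
(`isoH1_kummerMapOfRoots`, from `isoH1_kummerClass`); (3) the square with the reciprocity maps
commutes GIVEN the naturality of the local-duality isomorphisms `ιᵢ` (`recTargetMap_reciprocityMap`;
the `ιᵢ` are DATA — LCFT, [NSW] 7.2.6 — so their naturality is the named input, as in
`Iso.thm24i_of_inputs`). Nothing here concerns [IUTchIII]; no statement of abc-iut-L1-t7 is restated.
-/

namespace Literature.AlgebraicGeometry.Frobenioids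

namespace PadicKummer

open Kummer

namespace Def22Context.Iso

variable {X₁ X₂ : Def22Context} (e : Def22Context.Iso X₁ X₂) (N : ℕ)

/-! ### `O^□(A₁)^{H₁} ⥲ O^□(A₂)^{H₂}` -/

include e in
/-- `isoO` carries `H₁`-invariants to `H₂`-invariants and back.
[cite: MochizukiFrdII2008, Thm 2.4 (i) p.19] -/
theorem mem_invariantsSubmonoid_iff (x : X₁.O) :
    x ∈ invariantsSubmonoid X₁.O X₁.HA ↔ e.isoO x ∈ invariantsSubmonoid X₂.O X₂.HA := by
  constructor
  · intro hx k
    obtain ⟨k₁, rfl⟩ := e.isoHA.surjective k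
    rw [← e.isoO_smul_HA, hx k₁]
  · intro hx k₁
    apply e.isoO.injective
    rw [e.isoO_smul_HA]
    exact hx (e.isoHA k₁)

/-- `isoO (O^□(A₁)^{H₁}) = O^□(A₂)^{H₂}`. [cite: MochizukiFrdII2008, Thm 2.4 (i) p.19] -/
theorem map_invariantsSubmonoid :
    (invariantsSubmonoid X₁.O X₁.HA).map e.isoO.toMonoidHom = invariantsSubmonoid X₂.O X₂.HA := by
  ext y
  rw [Submonoid.mem_map]
  constructor
  · rintro ⟨x, hx, rfl⟩
    exact (e.mem_invariantsSubmonoid_iff x).mp hx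
  · intro hy
    refine ⟨e.isoO.symm y, ?_, e.isoO.apply_symm_apply y⟩
    rw [e.mem_invariantsSubmonoid_iff, MulEquiv.apply_symm_apply]
    exact hy

/-- **Theorem 2.4 (i)**, the isomorphism `O^□(A₁)^{H₁} ⥲ O^□(A₂)^{H₂}` (the restriction of
`O^□(A₁) ⥲ O^□(A₂)` to the invariants). [cite: MochizukiFrdII2008, Thm 2.4 (i) p.19] -/
noncomputable def isoInvariants :
    invariantsSubmonoid X₁.O X₁.HA ≃* invariantsSubmonoid X₂.O X₂.HA :=
  (e.isoO.submonoidMap (invariantsSubmonoid X₁.O X₁.HA)).trans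
    (MulEquiv.submonoidCongr e.map_invariantsSubmonoid)

/-- `isoInvariants` is `isoO` on elements. [cite: MochizukiFrdII2008, Thm 2.4 (i) p.19] -/
@[simp] theorem coe_isoInvariants (f : invariantsSubmonoid X₁.O X₁.HA) :
    ((e.isoInvariants f : invariantsSubmonoid X₂.O X₂.HA) : X₂.O) = e.isoO f := rfl

/-! ### Compatibility with the Kummer and reciprocity maps of Definition 2.3 -/

/-- **Theorem 2.4 (i), "compatible with the respective Kummer maps
`O^□(Aᵢ)^{Hᵢ} → H¹((Hᵢ)_{Aᵢ}, μ_N(Aᵢ))`"** — for abc-iut-L1-t7's Definition 2.3 Kummer map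
`Kummer.kummerMapOfRoots` (total on the invariants under `InvariantsAdmitRoots`): the square
`isoH1 ∘ κ₁ = κ₂ ∘ isoInvariants` commutes. [cite: MochizukiFrdII2008, Thm 2.4 (i) p.19] -/
theorem isoH1_kummerMapOfRoots (hO₁ : NthRootsDifferByUnits N X₁.O) (hO₂ : NthRootsDifferByUnits N X₂.O)
    (hR₁ : InvariantsAdmitRoots N X₁.O X₁.HA) (hR₂ : InvariantsAdmitRoots N X₂.O X₂.HA)
    (f : invariantsSubmonoid X₁.O X₁.HA) :
    e.isoH1 N (Multiplicative.toAdd (kummerMapOfRoots hO₁ hR₁ f)) =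
      Multiplicative.toAdd (kummerMapOfRoots hO₂ hR₂ (e.isoInvariants f)) := by
  rw [kummerMapOfRoots_apply, kummerMapOfRoots_apply, toAdd_ofAdd, toAdd_ofAdd]
  exact e.isoH1_kummerClass N hO₁ hO₂ _ _ rfl

/-- **Theorem 2.4 (i), "compatible with the respective reciprocity maps
`O^□(Aᵢ)^{Hᵢ} → (Hᵢ)^ab_{Aᵢ} ⊗ F_N(Aᵢ)`"** — for abc-iut-L1-t7's Definition 2.3 `Kummer.reciprocityMap`,
GIVEN the naturality `hι` of the local-duality isomorphisms `ιᵢ` (DATA; LCFT [NSW] 7.2.6) with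
respect to the induced maps: the square `(isoHA^ab ⊗ isoFN) ∘ ρ₁ = ρ₂ ∘ isoInvariants` commutes.
[cite: MochizukiFrdII2008, Thm 2.4 (i) p.19] -/
theorem recTargetMap_reciprocityMap (hO₁ : NthRootsDifferByUnits N X₁.O)
    (hO₂ : NthRootsDifferByUnits N X₂.O) (hR₁ : InvariantsAdmitRoots N X₁.O X₁.HA)
    (hR₂ : InvariantsAdmitRoots N X₂.O X₂.HA) (ι₁ : DualityIso N X₁.O X₁.HA X₁.qHA)
    (ι₂ : DualityIso N X₂.O X₂.HA X₂.qHA)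
    (hι : ∀ c, (e.thm24Data N).recTargetMap (ι₁.toAddEquiv c) = ι₂.toAddEquiv (e.isoH1 N c))
    (f : invariantsSubmonoid X₁.O X₁.HA) :
    (e.thm24Data N).recTargetMap (Multiplicative.toAdd (reciprocityMap hO₁ hR₁ ι₁ f)) =
      Multiplicative.toAdd (reciprocityMap hO₂ hR₂ ι₂ (e.isoInvariants f)) := by
  rw [reciprocityMap_apply, reciprocityMap_apply, toAdd_ofAdd, toAdd_ofAdd, eta, eta, hι]
  exact congrArg _ (e.isoH1_kummerClass N hO₁ hO₂ _ _ rfl)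

/-- The same two compatibilities with the side-`2` hypotheses DERIVED from the side-`1` ones by
transport (`nthRootsDifferByUnits_iff`, `invariantsAdmitRoots_iff`), packaged: along `e`, the
Kummer maps of Def. 2.3 correspond. [cite: MochizukiFrdII2008, Thm 2.4 (i) p.19] -/
theorem isoH1_kummerMapOfRoots' (hO₁ : NthRootsDifferByUnits N X₁.O)
    (hR₁ : InvariantsAdmitRoots N X₁.O X₁.HA) (f : invariantsSubmonoid X₁.O X₁.HA) :
    e.isoH1 N (Multiplicative.toAdd (kummerMapOfRoots hO₁ hR₁ f)) =
      Multiplicative.toAdd (kummerMapOfRoots ((e.nthRootsDifferByUnits_iff N).mp hO₁)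
        ((e.invariantsAdmitRoots_iff N).mp hR₁) (e.isoInvariants f)) :=
  e.isoH1_kummerMapOfRoots N hO₁ _ hR₁ _ f

end Def22Context.Iso

end PadicKummer

end Literature.AlgebraicGeometry.Frobenioids
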